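import Mathlib
import Summits.Ventures.HodgeRepro.BallGen
import Summits.Ventures.HodgeRepro.BallGenRational
import Summits.Ventures.HodgeRepro.MuTableSigns

/-!
# Route C's Hermitian form exists over every CM field (seat p2, gen 7)

Route C (ROUTE-C.md, BMM 2016 setting) works with a Hermitian space `V/E` of dimension `p + 1` over a CM field which is of
signature `(p,1)` at ONE archimedean place and positive definite at all the others.  This file constructs such a form on
the kernel for EVERY CM field `K`, every `p` and every distinguished embedding `φ₀ : K → ℂ`, in typer-2's vocabulary
(`BallGen.lean`: `Idx p = Fin p ⊕ Unit`, `J p = diag(1, …, 1, −1)`, `GLp p = GL (Idx p) ℂ`; «signature `(p,1)` at `φ₀`»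
= a Sylvester matrix `P` with `Pᴴ · (φ₀ H) · P = J p`, as in `RealApproxUnitary.dense_ratPointsOf`): the witness is
`H = diag(1, …, 1, a)` with `a ∈ K⁺` negative at `φ₀` and positive at every other place — the free-signs theorem
`MuTableSigns.exists_conj_fixed_with_signs` (weak approximation in `K⁺`).
-/

set_option autoImplicit false

namespace Summit.Ventures.HodgeRepro

open NumberField NumberField.InfinitePlace Matrix
open scoped ComplexConjugate ComplexOrder
open HodgeRepro.BallGen (Idx J GLp)

namespace MuTableSigns

variable {K : Type} [Field K] [NumberField K] [NumberField.IsCMField K]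

/-- An element fixed by complex conjugation takes real values under every complex embedding. -/
theorem im_map_eq_zero {a : K} (ha : IsCMField.complexConj K a = a) (φ : K →+* ℂ) : (φ a).im = 0 := by
  have h : conj (φ a) = φ a := by rw [← IsCMField.complexEmbedding_complexConj K φ a, ha]
  exact Complex.conj_eq_iff_im.1 h

omit [NumberField K] [NumberField.IsCMField K] in
/-- The real part of `φ a` is that of the representative embedding of the place of `φ`. -/
theorem re_embedding_mk (φ : K →+* ℂ) (a : K) : ((InfinitePlace.mk φ).embedding a).re = (φ a).re := by
  rcases InfinitePlace.embedding_mk_eq φ with h | h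
  · rw [h]
  · rw [h, ComplexEmbedding.conjugate_coe_eq, Complex.conj_re]

/-- **Route C's Hermitian form exists for every CM field, every `p`, every distinguished embedding `φ₀`.**  There is a
Hermitian `HK ∈ M_{p+1}(K)` (`star = complexConj`) of signature `(p,1)` at `φ₀` — a Sylvester matrix `P ∈ GL_{p+1}(ℂ)` with
`Pᴴ · (φ₀ HK) · P = J p` — which is positive definite under every embedding of a different infinite place.
Witness: `diag(1, …, 1, a)` with `a ∈ K⁺`, `φ₀(a) < 0`, `φ(a) > 0` elsewhere. -/
theorem exists_hermitian_sigP1_posDef (p : ℕ) (φ₀ : K →+* ℂ) :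
    ∃ HK : Matrix (Idx p) (Idx p) K, HKᴴ = HK ∧
      (∃ P : GLp p, (P : Matrix (Idx p) (Idx p) ℂ)ᴴ * HK.map φ₀ * (P : Matrix (Idx p) (Idx p) ℂ) = J p) ∧
      ∀ φ : K →+* ℂ, InfinitePlace.mk φ ≠ InfinitePlace.mk φ₀ → (HK.map φ).PosDef := by
  classical
  obtain ⟨a, ha, ha0, hs⟩ := exists_conj_fixed_with_signs (L := K) (fun w => decide (w ≠ InfinitePlace.mk φ₀))
  have hre : ∀ φ : K →+* ℂ, (0 < (φ a).re ↔ InfinitePlace.mk φ ≠ InfinitePlace.mk φ₀) := by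
    intro φ
    rw [← re_embedding_mk φ a, hs (InfinitePlace.mk φ)]
    simp
  have him : ∀ φ : K →+* ℂ, (φ a).im = 0 := fun φ => im_map_eq_zero ha φ
  have hne : ∀ φ : K →+* ℂ, (φ a).re ≠ 0 := by
    intro φ h0
    apply ha0
    apply φ.injective
    rw [map_zero]
    exact Complex.ext h0 (him φ)
  have hreal : ∀ φ : K →+* ℂ, φ a = (((φ a).re : ℝ) : ℂ) := fun φ => Complex.ext rfl (by simp [him φ])
  set r : ℝ := (φ₀ a).re with hr
  have hr0 : r < 0 := lt_of_le_of_ne (not_lt.1 (fun h => (hre φ₀).1 h rfl)) (hne φ₀)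
  refine ⟨diagonal (Sum.elim (fun _ => 1) (fun _ => a)), ?_, ?_, ?_⟩
  · rw [diagonal_conjTranspose]
    congr 1
    funext i
    rcases i with i | i
    · simp
    · exact ha
  · set s : ℝ := (Real.sqrt (-r))⁻¹ with hs_def
    have hs0 : s ≠ 0 := inv_ne_zero (Real.sqrt_ne_zero'.2 (neg_pos.2 hr0))
    have hss : s * r * s = -1 := by
      have h1 : s * s = (-r)⁻¹ := by rw [hs_def, ← mul_inv, Real.mul_self_sqrt (by linarith)]
      calc s * r * s = (s * s) * r := by ring
        _ = (-r)⁻¹ * r := by rw [h1]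
        _ = -1 := by rw [← neg_inv, neg_mul, inv_mul_cancel₀ hr0.ne]
    let Pm : Matrix (Idx p) (Idx p) ℂ := diagonal (Sum.elim (fun _ => (1 : ℂ)) (fun _ => (s : ℂ)))
    have hdet : Pm.det ≠ 0 := by
      rw [det_diagonal]
      exact Finset.prod_ne_zero_iff.2 (fun i _ => by rcases i with i | i <;> simp [hs0])
    refine ⟨((Matrix.isUnit_iff_isUnit_det Pm).2 (isUnit_iff_ne_zero.2 hdet)).unit, ?_⟩
    rw [IsUnit.unit_spec]
    show Pmᴴ * (diagonal (Sum.elim (fun _ => (1 : K)) (fun _ => a))).map φ₀ * Pm = J p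
    rw [diagonal_map (map_zero φ₀), diagonal_conjTranspose, diagonal_mul_diagonal, diagonal_mul_diagonal]
    show _ = diagonal (Sum.elim (fun _ => 1) (fun _ => -1))
    congr 1
    funext i
    rcases i with i | i
    · simp
    · simp only [Pi.star_apply, Sum.elim_inr, Complex.star_def, Complex.conj_ofReal]
      rw [hreal φ₀, ← hr]
      exact_mod_cast hss
  · intro φ hφ
    rw [diagonal_map (map_zero φ), posDef_diagonal_iff]
    intro i
    rcases i with i | i
    · simp
    · simp only [Sum.elim_inr]
      rw [hreal φ]
      exact Complex.zero_lt_real.2 ((hre φ).2 hφ)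

/-- Transport of the Hermitian value `v̄ᵀ H v` along an embedding `φ`: `φ (star v ⬝ᵥ H v) = star (φ ∘ v) ⬝ᵥ (φ H) (φ ∘ v)`
(`φ` intertwines the CM conjugation and complex conjugation). -/
theorem map_star_dotProduct_mulVec {p : ℕ} (φ : K →+* ℂ) (HK : Matrix (Idx p) (Idx p) K) (v : Idx p → K) :
    φ (star v ⬝ᵥ (HK *ᵥ v)) = star (φ ∘ v) ⬝ᵥ ((HK.map φ) *ᵥ (φ ∘ v)) := by
  rw [RingHom.map_dotProduct]
  have h1 : φ ∘ star v = star (φ ∘ v) := by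
    funext i
    exact HodgeRepro.BallGen.map_star_eq φ (v i)
  have h2 : φ ∘ (HK *ᵥ v) = HK.map φ *ᵥ (φ ∘ v) := by
    funext i
    exact RingHom.map_mulVec φ HK v i
  rw [h1, h2]

/-- **Anisotropy**: a Hermitian form over `K` that is positive definite at SOME infinite place other than the place of
`φ₀` (so as soon as `K⁺ ≠ ℚ`) represents `0` only trivially: `star v ⬝ᵥ H v ≠ 0` for every `v ≠ 0`.  (Route C / BMM:
«signature `(p,1)` at one place and definite at the others ⇒ anisotropic».) -/
theorem anisotropic_of_posDef_other {p : ℕ} (φ₀ : K →+* ℂ) (HK : Matrix (Idx p) (Idx p) K)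
    (hpos : ∀ φ : K →+* ℂ, InfinitePlace.mk φ ≠ InfinitePlace.mk φ₀ → (HK.map φ).PosDef)
    (hK : ∃ w : InfinitePlace K, w ≠ InfinitePlace.mk φ₀) :
    ∀ v : Idx p → K, v ≠ 0 → star v ⬝ᵥ (HK *ᵥ v) ≠ 0 := by
  intro v hv h0
  obtain ⟨w, hw⟩ := hK
  have hφ : InfinitePlace.mk w.embedding ≠ InfinitePlace.mk φ₀ := by rwa [InfinitePlace.mk_embedding]
  have hpd := hpos w.embedding hφ
  have hv' : w.embedding ∘ v ≠ 0 := by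
    intro h
    apply hv
    funext i
    have := congrFun h i
    simp only [Function.comp_apply, Pi.zero_apply] at this
    exact w.embedding.injective (by rw [this]; exact (map_zero _).symm)
  have hlt := hpd.dotProduct_mulVec_pos hv'
  rw [← map_star_dotProduct_mulVec, h0, map_zero] at hlt
  exact lt_irrefl _ hlt

/-- **Route C's Hermitian form exists and is anisotropic** as soon as `K` has a second infinite place (`K⁺ ≠ ℚ`). -/
theorem exists_hermitian_sigP1_posDef_anisotropic (p : ℕ) (φ₀ : K →+* ℂ)
    (hK : ∃ w : InfinitePlace K, w ≠ InfinitePlace.mk φ₀) :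
    ∃ HK : Matrix (Idx p) (Idx p) K, HKᴴ = HK ∧
      (∃ P : GLp p, (P : Matrix (Idx p) (Idx p) ℂ)ᴴ * HK.map φ₀ * (P : Matrix (Idx p) (Idx p) ℂ) = J p) ∧
      (∀ φ : K →+* ℂ, InfinitePlace.mk φ ≠ InfinitePlace.mk φ₀ → (HK.map φ).PosDef) ∧
      ∀ v : Idx p → K, v ≠ 0 → star v ⬝ᵥ (HK *ᵥ v) ≠ 0 := by
  obtain ⟨HK, hH, hP, hpos⟩ := exists_hermitian_sigP1_posDef (K := K) p φ₀
  exact ⟨HK, hH, hP, hpos, anisotropic_of_posDef_other φ₀ HK hpos hK⟩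

end MuTableSigns

end Summit.Ventures.HodgeRepro
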